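import Summits.ResolutionOfSingularities.ResolutionOfSingularities.Theorems.RadicialJungCleanModelsStubCossartPiltant2019LeavesClosed
import Literature.AlgebraicGeometry.Resolution.LUCompleteChar0TrustBase
import HarnessLib

/-!
# `CleanModels`, stub 2 (F-02) BY ITS TYPE `CossartPiltant2019.{0}` from {`CossartPiltant2019Local`, stub 1, `hEqT`, `hEqI`,
# `Hironaka1964_local`} — the geometric head of CP 2019 Prop. 4.8 no longer a leaf

OURS (decomp-res hand-1 g19; crux `stmt-ResolutionOfSingularities-15917`, skeleton rev 35
`Cruxes/CleanModels/Lines/Sketch.lean`, stub `stub_cossartPiltant2019 : CossartPiltant2019.{0}`). A BOOKKEEPING file continuing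
`RadicialJungCleanModelsStubCossartPiltant2019Leaves{,RankOne,CharP,QuotientLU,Closed}.lean`.

Hand-1 g16/g17 reached `cossartPiltant2019_of_stub1_of_leaves[_headChoiceRankOne]` : `CossartPiltant2019Local → CossartJannsenSaito2020Embedded
(= TYPE of stub 1) → hEqT → hEqI → Hironaka1964_local → (geometric head of CP 2019 Prop. 4.8) → CossartPiltant2019`.  With the head proved
in kernel by hand-1 g19 (`Literature/AlgebraicGeometry/Resolution/ArithmeticalThreefoldsDescentHeadQuotientLU.lean` + `LUCompleteDimLETwo.lean`),
the TYPE of stub 2 follows from the four remaining leaves, for fields of every characteristic: at a field `k` of characteristic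
`p`, (LU) for the three-dimensional quotients of the `B̂_𝔭` (complete, residue characteristic `p`) is `CossartPiltant2019ReductionP`
(from `CossartPiltant2019Local`, stub 1, `hEqT`, `hEqI`) when `p` is prime and `Hironaka1964_local` (Temkin 2008) when `p = 0`.

* `cpLocalUniformization_quotient_completion_of_luComplete'` — the dimension sorting of the quotients of `B̂_𝔭`, any characteristic;
* `localUniformization3_of_stub1_of_luComplete3` — `LocalUniformization3 k` (any `k`, `CharP k p`) from stub 1 and (LU) for complete
  three-dimensional local domains of residue characteristic `p`;
* `cossartPiltant2019_of_stub1_of_equivariantLU_of_hironaka` — **`CossartPiltant2019.{0}` from `CossartPiltant2019Local.{0}`,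
  `CossartJannsenSaito2020Embedded.{0}`, `hEqT`, `hEqI`, `Hironaka1964_local.{0}`** (principalization and patching proved in the tree).

Nothing here proves resolution of singularities in positive characteristic, local uniformization in dimension three, or any
statement of a manuscript under adjudication; rung 0. AI-written; AI review weaker than expert review.
-/

-- `Summit.<Summit>.<Sub>.Theorems` with `Sub = Summit` (single-conjunct summit, D-0017)
set_option linter.dupNamespace false

noncomputable section

open IsLocalRing Polynomial AlgebraicGeometry
open Literature.AlgebraicGeometry.Resolution
open Summit.ResolutionOfSingularities.ResolutionOfSingularities.Theorems.CP2008Prop44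

namespace Summit.ResolutionOfSingularities.ResolutionOfSingularities.Theorems.RadicialJung.CleanModels

/-- **(LU) for every quotient of `B̂_𝔭` from (LU) in dimension `3` (residue characteristic `p`, ANY `p`) and the proved (LU) in
dimension `≤ 2`.** As `cpLocalUniformization_quotient_completion_of_luComplete`, without primality of `p` and with the
dimension-`≤ 2` input discharged (`cpLocalUniformization_of_isAdicComplete_of_ringKrullDim_le_two`).
[cite: CossartPiltant2019, proof of Prop. 4.8 and Prop. 4.10 (arXiv v1: Props. 4.6, 4.8)] [cite: CossartJannsenSaito2020, Thm. 1.4] -/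
theorem cpLocalUniformization_quotient_completion_of_luComplete' (p : ℕ)
    (hCJSE : CossartJannsenSaito2020Embedded.{0})
    (hLU3 : ∀ (A : Type) [CommRing A] [IsDomain A] [IsLocalRing A] [IsNoetherianRing A]
        [IsAdicComplete (maximalIdeal A) A],
        ringKrullDim A = 3 → CharP (ResidueField A) p → CPLocalUniformization A)
    (k : Type) [Field k] [CharP k p]
    (B : Type) [CommRing B] [IsDomain B] [Algebra k B] [Algebra.FiniteType k B]
    (𝔭 : Ideal B) [𝔭.IsPrime] (hdim : ringKrullDim (Localization.AtPrime 𝔭) = 3)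
    (R : Type) [CommRing R] [IsDomain R] [IsLocalRing R]
    (π : AdicCompletion (maximalIdeal (Localization.AtPrime 𝔭)) (Localization.AtPrime 𝔭) →+* R)
    (hπ : Function.Surjective π) : CPLocalUniformization R := by
  set A := Localization.AtPrime 𝔭 with hAdef
  haveI : IsNoetherianRing B := Algebra.FiniteType.isNoetherianRing k B
  haveI : IsNoetherianRing A := IsLocalization.isNoetherianRing 𝔭.primeCompl _ inferInstance
  set Ah := AdicCompletion (maximalIdeal A) A with hAhdef
  haveI : IsNoetherianRing Ah := isNoetherianRing_adicCompletion_maximalIdeal A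
  haveI : IsNoetherianRing R := isNoetherianRing_of_surjective Ah R π hπ
  haveI : IsAdicComplete (maximalIdeal R) R := isAdicComplete_of_surjective π hπ
  haveI hchar : CharP (ResidueField R) p := by
    let f : k →+* ResidueField R :=
      (IsLocalRing.residue R).comp (π.comp ((algebraMap A Ah).comp (algebraMap k A)))
    exact charP_of_injective_ringHom f.injective p
  have hle : ringKrullDim R ≤ 3 := by
    calc ringKrullDim R ≤ ringKrullDim Ah := ringKrullDim_le_of_surjective π hπ
      _ = ringKrullDim A := ringKrullDim_adicCompletion A
      _ = 3 := hdim
  obtain ⟨n, hn⟩ := exists_ringKrullDim_eq_natCast R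
  rw [hn] at hle
  have hn3 : n ≤ 3 := by exact_mod_cast hle
  rcases Nat.lt_or_ge n 3 with hlt | hge
  · refine cpLocalUniformization_of_isAdicComplete_of_ringKrullDim_le_two hCJSE R ?_
    rw [hn]; exact_mod_cast (Nat.lt_succ_iff.mp hlt)
  · refine hLU3 R ?_ hchar
    rw [hn]; exact_mod_cast le_antisymm hn3 hge

/-- **`LocalUniformization3 k` for a field of ANY characteristic `p` (`CharP k p`, `p` prime or `0`) from stub 1 and (LU) for
complete three-dimensional local domains of residue characteristic `p`.** [cite: CossartPiltant2019, Thm. 1.5, Props. 4.8, 4.10]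
[cite: CossartJannsenSaito2020, Thm. 1.2, Thm. 1.4, Cor. 1.5] [cite: NovacoskiSpivakovsky2014, Thm. 1.1, Cor. 2.17, §3.1] -/
theorem localUniformization3_of_stub1_of_luComplete3 (p : ℕ)
    (hCJSE : CossartJannsenSaito2020Embedded.{0})
    (hLU3 : ∀ (A : Type) [CommRing A] [IsDomain A] [IsLocalRing A] [IsNoetherianRing A]
        [IsAdicComplete (maximalIdeal A) A],
        ringKrullDim A = 3 → CharP (ResidueField A) p → CPLocalUniformization A)
    (k : Type) [Field k] [CharP k p] : LocalUniformization3 k :=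
  localUniformization3_of_quotientLU (cossartJannsenSaito2020_of_embedded hCJSE) k
    (stub_cjs2020Cor15_of_embedded hCJSE)
    fun B _ _ _ _ 𝔭 _ _ h2 R _ _ _ π hπ =>
      cpLocalUniformization_quotient_completion_of_luComplete' p hCJSE hLU3 k B 𝔭 h2 R π hπ

/-- **The TYPE of stub 2, `CossartPiltant2019.{0}` (weak resolution of reduced separated schemes of finite type of dimension `≤ 3`
over every field), from `CossartPiltant2019Local.{0}` (CP 2019 Thm. 1.5, printed), `CossartJannsenSaito2020Embedded.{0}` (CJS
Thm. 1.4 = the type of stub 1, printed), the research leaves `hEqT`, `hEqI` (equivariant local uniformization in the tame and the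
inseparable layer of CP 2019 Prop. 4.10), and `Hironaka1964_local.{0}` (Hironaka / Temkin 2008, used only at characteristic `0`).**
Proof: for a field `k` of characteristic `p`, (LU) for complete three-dimensional local domains of residue characteristic `p` is
`cossartPiltant2019ReductionP_of_embPrinted_of_equivariantLU_split` (`p` prime) or `Hironaka1964_local.cpLocalUniformization_of_isAdicComplete`
(`p = 0`); then `localUniformization3_of_stub1_of_luComplete3` and the proved patching. Compared with hand-1 g17's
`cossartPiltant2019_of_stub1_of_leaves_headChoiceRankOne` the geometric-head leaf is GONE.
[cite: CossartPiltant2019, Thm. 1.1, Thm. 1.5, Props. 4.4, 4.6, 4.8, 4.10] [cite: CossartJannsenSaito2020, Thm. 1.2, Thm. 1.4, Cor. 1.5]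
[cite: Temkin2008, Thm. 1.1] [cite: NovacoskiSpivakovsky2014, Thm. 1.1, Cor. 2.17, §3.1] -/
theorem cossartPiltant2019_of_stub1_of_equivariantLU_of_hironaka
    (hloc : CossartPiltant2019Local.{0}) (hCJSE : CossartJannsenSaito2020Embedded.{0})
    (hEqT :
      ∀ (p : ℕ), p.Prime →
      ∀ (S : Type) [CommRing S] [IsDomain S] [IsRegularLocalRing S],
        IsExcellentRing S → ringKrullDim S = 3 → CharP (ResidueField S) p →
        IsAdicComplete (maximalIdeal S) S →
      ∀ (E : Type) [Field E] [Algebra S E], Function.Injective (algebraMap S E) →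
        IsAlgClosed E → Algebra.IsAlgebraic S E →
      ∀ (OE : ValuationSubring E), (∀ s : S, algebraMap S E s ∈ OE) →
        (∀ s ∈ maximalIdeal S, OE.valuation (algebraMap S E s) < 1) →
        (∀ y : OE, ∃ q : S[X], (∃ i, q.coeff i ∉ maximalIdeal S) ∧
          OE.valuation (q.eval₂ (algebraMap S E) y) < 1) →
      Nonempty OE.valuation.RankOne →
      ∀ (M' : Subfield E), (∀ s : S, algebraMap S E s ∈ M') →
      ∀ (H : Subgroup (E ≃ₐ[S] E)),
        (∀ σ ∈ H, ∀ x ∈ M', σ x ∈ M') →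
        (∀ σ ∈ H, ∀ x ∈ M', x ∈ OE → σ x ∈ OE) →
        (∀ σ ∈ H, ∀ x ∈ M', x ∈ OE → OE.valuation (σ x - x) < 1) →
        (∃ ℓ : ℕ, ℓ.Prime ∧ ℓ ≠ p ∧ ∀ σ ∈ H, ∀ x ∈ M', (σ ^ ℓ) x = x) →
        (∀ σ ∈ H, (∃ x ∈ M', σ x ≠ x) →
          ∃ x ∈ M', x ≠ 0 ∧ OE.valuation (σ x - x) = OE.valuation x) →
        (∃ t : Finset E, (t : Set E) ⊆ M' ∧
          M' ≤ Subfield.closure (Set.range (algebraMap S E) ∪ (t : Set E)) ∧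
          ∃ hTO : (Algebra.adjoin S (t : Set E)).toSubring ≤ OE.toSubring,
            IsRegularLocalRing (Localization.AtPrime
              (Ideal.comap (Subring.inclusion hTO) (maximalIdeal OE)))) →
        ∃ t : Finset E, (t : Set E) ⊆ M' ∧
          M' ≤ Subfield.closure (Set.range (algebraMap S E) ∪ (t : Set E)) ∧
          ∃ hTO : (Algebra.adjoin S (t : Set E)).toSubring ≤ OE.toSubring,
            IsRegularLocalRing (Localization.AtPrime
              (Ideal.comap (Subring.inclusion hTO) (maximalIdeal OE))) ∧
            (∀ σ ∈ H, ∀ x ∈ locAtCentre (Algebra.adjoin S (t : Set E)).toSubring OE,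
              σ x ∈ locAtCentre (Algebra.adjoin S (t : Set E)).toSubring OE))
    (hEqI :
      ∀ (p : ℕ), p.Prime →
      ∀ (S : Type) [CommRing S] [IsDomain S] [IsRegularLocalRing S],
        IsExcellentRing S → ringKrullDim S = 3 → CharP (ResidueField S) p →
        IsAdicComplete (maximalIdeal S) S →
      ∀ (E : Type) [Field E] [Algebra S E], Function.Injective (algebraMap S E) →
        IsAlgClosed E → Algebra.IsAlgebraic S E →
      ∀ (OE : ValuationSubring E), (∀ s : S, algebraMap S E s ∈ OE) →
        (∀ s ∈ maximalIdeal S, OE.valuation (algebraMap S E s) < 1) →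
        (∀ y : OE, ∃ q : S[X], (∃ i, q.coeff i ∉ maximalIdeal S) ∧
          OE.valuation (q.eval₂ (algebraMap S E) y) < 1) →
      Nonempty OE.valuation.RankOne →
      ∀ (M' : Subfield E), (∀ s : S, algebraMap S E s ∈ M') →
      ∀ (H : Subgroup (E ≃ₐ[S] E)),
        (∀ σ ∈ H, ∀ x ∈ M', σ x ∈ M') →
        (∀ σ ∈ H, ∀ x ∈ M', x ∈ OE → σ x ∈ OE) →
        (∀ σ ∈ H, (∃ x ∈ M', σ x ≠ x) →
          ∃ x ∈ M', OE.valuation x = 1 ∧ OE.valuation (σ x - x) = 1) →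
      ∀ (x₀ : E), x₀ ∈ M' → x₀ ∈ OE →
        (∃ t : Finset E, (t : Set E) ⊆ M' ∧
          M' ≤ Subfield.closure (Set.range (algebraMap S E) ∪ (t : Set E)) ∧
          ∃ hTO : (Algebra.adjoin S (t : Set E)).toSubring ≤ OE.toSubring,
            IsRegularLocalRing (Localization.AtPrime
              (Ideal.comap (Subring.inclusion hTO) (maximalIdeal OE)))) →
        ∃ t : Finset E, (t : Set E) ⊆ M' ∧
          M' ≤ Subfield.closure (Set.range (algebraMap S E) ∪ (t : Set E)) ∧
          ∃ hTO : (Algebra.adjoin S (t : Set E)).toSubring ≤ OE.toSubring,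
            IsRegularLocalRing (Localization.AtPrime
              (Ideal.comap (Subring.inclusion hTO) (maximalIdeal OE))) ∧
            (∀ σ ∈ H, ∀ x ∈ locAtCentre (Algebra.adjoin S (t : Set E)).toSubring OE,
              σ x ∈ locAtCentre (Algebra.adjoin S (t : Set E)).toSubring OE) ∧
            x₀ ∈ locAtCentre (Algebra.adjoin S (t : Set E)).toSubring OE)
    (hH : Hironaka1964_local.{0}) : CossartPiltant2019.{0} := by
  intro k _ X f hsep hlft hqc hred hdim
  obtain ⟨p, hp⟩ := CharP.exists k
  have hLU3 : ∀ (A : Type) [CommRing A] [IsDomain A] [IsLocalRing A] [IsNoetherianRing A]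
      [IsAdicComplete (maximalIdeal A) A],
      ringKrullDim A = 3 → CharP (ResidueField A) p → CPLocalUniformization A := by
    intro A _ _ _ _ _ hdimA hchar
    rcases CharP.char_is_prime_or_zero k p with hprime | h0
    · exact cossartPiltant2019ReductionP_of_embPrinted_of_equivariantLU_split hloc
        CossartPiltant2019Principalization_holds hCJSE hEqT hEqI hloc p hprime A hdimA hchar
    · subst h0
      haveI : CharZero (ResidueField A) := CharP.charP_to_charZero (ResidueField A)
      exact hH.cpLocalUniformization_of_isAdicComplete A inferInstance
  exact CossartPiltant2019Patching_holds k (cossartJannsenSaito2020_of_embedded hCJSE k)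
    (localUniformization3_of_stub1_of_luComplete3 p hCJSE hLU3 k) X f hsep hlft hqc hred hdim

end Summit.ResolutionOfSingularities.ResolutionOfSingularities.Theorems.RadicialJung.CleanModels

end
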